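import Literature.AnabelianGeometry.SemiGraphs.ProfiniteSemiGraphIsoTransport
import HarnessLib

/-!
# Transport of approximators along isomorphisms of profinite presentations: quasi-coherence and
# total elevation descend (route T, TRANSPORT II)

Mochizuki, *Semi-graphs of anabelioids*, Publ. RIMS **42** (2006), §2 Def. 2.3 (i)–(iii) pp. 24–25
(approximators, quasi-coherence), Def. 2.4 (i) p. 25 (elevated vertices) [cite: MochizukiSemiAnbd2006,
Def 2.3 pp.24-25].  For `F : X → Y` a morphism of profinite presentations with `IsIso F.base` and
bijective constituent homomorphisms (`IsLocallyTrivial`; the data of abc-iut-L3-t3's `Hom.IsoOver`):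

* `exists_approximator_of_iso` — an approximator `A` of `Y` PULLS BACK to an approximator of `X`:
  `F'_v := F_{F v}`, `π'_v := π_{F v} ∘ hV_v`, branch maps those of `A` at `F b` re-indexed along
  `edgeOf (F b) = F (edgeOf b)`; `π₁`-epimorphic if `A` is, kernels = preimages, vertex groups and
  branch images literally those of `A` (so elevating subgroups pull back verbatim);
* `isTotallyElevated_of_iso` — **Def. 2.4 (i) descends**;
* `isQuasiCoherent_of_iso` — **Def. 2.3 (iii) descends**: a family of coverings of the constituents of
  `X` is pushed to `Y` along the inverses `Π_{F⁻¹ w} ⥲ Π_w` (restriction of scalars `BTemp.res`), split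
  there, and the splitting approximator pulled back.

Proof-only (abc-iut cell, L3 route T · TRANSPORT; seat abc-iut-L3-d6); no definition (approximators
are `∃`-witnesses); nothing here bears on [IUTchIII] Cor. 3.12.
-/

open CategoryTheory Topology

namespace Literature.AnabelianGeometry.SemiGraphs

namespace ProfiniteSemiGraph

universe u

variable {X Y : ProfiniteSemiGraph.{u}} (F : Hom X Y)

/-! ### Re-indexing homomorphisms out of the edge groups of an approximator -/

section Cast

variable {F} (A : Y.Approximator)

/-- Re-indexing along an equality of edges preserves injectivity. [cite: MochizukiSemiAnbd2006, Def 2.3 pp.24-25] -/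
private theorem cast_hom_injective {e₁ e₂ : Y.graph.Edge} (h : e₁ = e₂) {T : Type u} [Group T]
    (m : A.FE e₁ →* T) (hm : Function.Injective m) :
    Function.Injective (h ▸ m : A.FE e₂ →* T) := by
  subst h; exact hm

/-- Re-indexing along an equality of edges commutes with `π_e` up to the transport `castGe`.
[cite: MochizukiSemiAnbd2006, Def 2.3 pp.24-25] -/
private theorem cast_hom_apply_πE {e₁ e₂ : Y.graph.Edge} (h : e₁ = e₂) {T : Type u} [Group T]
    (m : A.FE e₁ →* T) (z : Y.Ge e₂) :
    (h ▸ m : A.FE e₂ →* T) (A.πE e₂ z) = m (A.πE e₁ (Y.castGe h.symm z)) := by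
  subst h; rfl

/-- Re-indexing along an equality of edges preserves the range. [cite: MochizukiSemiAnbd2006, Def 2.3 pp.24-25] -/
private theorem cast_hom_range {e₁ e₂ : Y.graph.Edge} (h : e₁ = e₂) {T : Type u} [Group T]
    (m : A.FE e₁ →* T) : (h ▸ m : A.FE e₂ →* T).range = m.range := by
  subst h; rfl

end Cast

/-! ### Pulling back an approximator -/

/-- **Pull-back of approximators along `F`** (constituent homomorphisms bijective): for an
approximator `A` of `Y` there is an approximator `A'` of `X` with `F'_v = F_{F v}`,
`π'_v = π_{F v} ∘ hV_v` (so `Ker π'_v = hV_v⁻¹(Ker π_{F v})`), `π₁`-epimorphic when `A` is, and whose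
branch images at `v` are LITERALLY the branch images of `A` at `F v` along the branches `F b` — so a
subgroup of `F_{F v}` elevating `F v` elevates `v`. [cite: MochizukiSemiAnbd2006, Def 2.3 pp.24-25] -/
theorem exists_approximator_of_iso (hlt : F.IsLocallyTrivial) (A : Y.Approximator) :
    ∃ A' : X.Approximator,
      (A.IsPiOneEpimorphic → A'.IsPiOneEpimorphic) ∧
      (∀ (v : X.graph.Vertex) (k : X.Gv v),
        A'.πV v k = 1 ↔ A.πV (F.base.vertexMap v) (F.hV v k) = 1) ∧
      (∀ (e : X.graph.Edge) (k : X.Ge e),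
        A'.πE e k = 1 ↔ A.πE (F.base.edgeMap e) (F.hE e k) = 1) ∧
      ∀ (v : X.graph.Vertex) (N : Subgroup (A.FV (F.base.vertexMap v))),
        (∀ (b₁ : Y.graph.Branch) (h₁ : Y.graph.abuts b₁ = some (F.base.vertexMap v))
            (g : A.FV (F.base.vertexMap v)),
            N ⊓ ((A.brF b₁ _ h₁).range.map (MulAut.conj g).toMonoidHom) = ⊥) →
          ∃ N' : Subgroup (A'.FV v), Nat.card N' = Nat.card N ∧
            ∀ (b : X.graph.Branch) (h : X.graph.abuts b = some v) (g' : A'.FV v),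
              N' ⊓ ((A'.brF b v h).range.map (MulAut.conj g').toMonoidHom) = ⊥ := by
  classical
  choose c hc using fun b v h => F.exists_comm_castGe b v h
  choose gA hgA using A.comm
  -- the re-indexed branch maps
  let brF' : ∀ (b : X.graph.Branch) (v : X.graph.Vertex), X.graph.abuts b = some v →
      (A.FE (F.base.edgeMap (X.graph.edgeOf b)) →* A.FV (F.base.vertexMap v)) := fun b v h =>
    (F.base.edgeOf_branchMap b ▸
      A.brF (F.base.branchMap b) (F.base.vertexMap v) (F.base.abuts_branchMap b v h) :
        A.FE (F.base.edgeMap (X.graph.edgeOf b)) →* A.FV (F.base.vertexMap v))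
  have hinj : ∀ b v h, Function.Injective (brF' b v h) := fun b v h =>
    cast_hom_injective A (F.base.edgeOf_branchMap b) _ (A.brF_injective _ _ _)
  have happly : ∀ b v h (z : Y.Ge (F.base.edgeMap (X.graph.edgeOf b))),
      brF' b v h (A.πE _ z) = A.brF (F.base.branchMap b) (F.base.vertexMap v)
        (F.base.abuts_branchMap b v h) (A.πE _ (Y.castGe (F.base.edgeOf_branchMap b).symm z)) :=
    fun b v h z => cast_hom_apply_πE A (F.base.edgeOf_branchMap b) _ z
  have hrange : ∀ b v h, (brF' b v h).range =
      (A.brF (F.base.branchMap b) _ (F.base.abuts_branchMap b v h)).range := fun b v h =>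
    cast_hom_range A (F.base.edgeOf_branchMap b) _
  -- compatibility with the branch maps of `X`
  have hcomm : ∀ (b : X.graph.Branch) (v : X.graph.Vertex) (h : X.graph.abuts b = some v),
      ∃ g' : A.FV (F.base.vertexMap v), ∀ x : X.Ge (X.graph.edgeOf b),
        brF' b v h (((A.πE _).comp (F.hE (X.graph.edgeOf b)).toMonoidHom) x) =
          g' * ((A.πV _).comp (F.hV v).toMonoidHom) (X.brHom b v h x) * g'⁻¹ := by
    intro b v h
    refine ⟨gA (F.base.branchMap b) (F.base.vertexMap v) (F.base.abuts_branchMap b v h) *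
      (A.πV _ (c b v h))⁻¹, fun x => ?_⟩
    change brF' b v h (A.πE _ (F.hE _ x)) = _ * A.πV _ (F.hV v (X.brHom b v h x)) * _
    rw [happly b v h, hgA, hc b v h, map_mul, map_mul, map_inv]
    group
  obtain ⟨M, hM, hdvd⟩ := A.bounded
  let A' : X.Approximator :=
    { FV := fun v => A.FV (F.base.vertexMap v)
      FE := fun e => A.FE (F.base.edgeMap e)
      πV := fun v => (A.πV _).comp (F.hV v).toMonoidHom
      πE := fun e => (A.πE _).comp (F.hE e).toMonoidHom
      isOpen_ker_πV := fun v => by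
        rw [← MonoidHom.comap_ker, Subgroup.coe_comap]
        exact (A.isOpen_ker_πV _).preimage (F.hV v).continuous
      isOpen_ker_πE := fun e => by
        rw [← MonoidHom.comap_ker, Subgroup.coe_comap]
        exact (A.isOpen_ker_πE _).preimage (F.hE e).continuous
      brF := brF'
      brF_injective := hinj
      comm := hcomm
      bounded := ⟨M, hM, fun v => hdvd _⟩ }
  refine ⟨A', fun hA => ⟨fun v => (hA.1 _).comp (hlt.1 v).2, fun e => (hA.2 _).comp (hlt.2 e).2⟩,
    fun v k => Iff.rfl, fun e k => Iff.rfl, fun v N hN => ⟨N, rfl, fun b h g' => ?_⟩⟩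
  change N ⊓ ((brF' b v h).range.map (MulAut.conj g').toMonoidHom) = ⊥
  rw [hrange b v h]
  exact hN _ _ g'

/-! ### Total elevation descends -/

/-- **Total elevation descends along an isomorphism of presentations** (Def. 2.4 (i)): the subgroup
`N_M ⊆ F_{F v}` elevating `F v` elevates `v` for the pulled-back approximator.
[cite: MochizukiSemiAnbd2006, Def 2.4(i) p.25] -/
theorem isTotallyElevated_of_iso (hlt : F.IsLocallyTrivial) (hY : Y.IsTotallyElevated) :
    X.IsTotallyElevated := by
  intro v M
  obtain ⟨A, hAepi, N, hN, hNdisj⟩ := hY (F.base.vertexMap v) M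
  obtain ⟨A', hepi, -, -, helev⟩ := exists_approximator_of_iso F hlt A
  obtain ⟨N', hcard, hdisj⟩ := helev v N hNdisj
  exact ⟨A', hepi hAepi, N', hcard ▸ hN, hdisj⟩

/-! ### Quasi-coherence descends -/

/-- Transport of "acts trivially" along the identification of `v'` with `v`. [cite: MochizukiSemiAnbd2006, Def 2.3(iii) p.25] -/
private theorem forall_ρ_eq_of_castGv (HV : ∀ v : X.graph.Vertex, BTemp (X.Gv v)) {v v' : X.graph.Vertex}
    (hv : v' = v) (k : X.Gv v) (k' : X.Gv v') (hk : X.castGv hv k' = k)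
    (h : ∀ x : (HV v').obj.V, (HV v').obj.ρ k' x = x) : ∀ x : (HV v).obj.V, (HV v).obj.ρ k x = x := by
  subst hv; subst hk; simpa using h

/-- Edge version. [cite: MochizukiSemiAnbd2006, Def 2.3(iii) p.25] -/
private theorem forall_ρ_eq_of_castGe (HE : ∀ e : X.graph.Edge, BTemp (X.Ge e)) {e e' : X.graph.Edge}
    (he : e' = e) (k : X.Ge e) (k' : X.Ge e') (hk : X.castGe he k' = k)
    (h : ∀ x : (HE e').obj.V, (HE e').obj.ρ k' x = x) : ∀ x : (HE e).obj.V, (HE e).obj.ρ k x = x := by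
  subst he; subst hk; simpa using h

/-- The round trip `X.Gv v → Y.Gv (F v) = Y.Gv (F v') → X.Gv v' → X.Gv v` is the identity (`v' = v`).
[cite: MochizukiSemiAnbd2006, Def 2.2(ii) p.24] -/
private theorem castGv_symm_castGv_hV {v v' : X.graph.Vertex} (hv : v' = v)
    (h2 : F.base.vertexMap v = F.base.vertexMap v')
    (e : X.Gv v' ≃ₜ* Y.Gv (F.base.vertexMap v')) (he : ∀ x, e x = F.hV v' x) (k : X.Gv v) :
    X.castGv hv (e.symm (Y.castGv h2 (F.hV v k))) = k := by
  subst hv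
  rw [castGv_rfl, castGv_rfl, ← he, ContinuousMulEquiv.symm_apply_apply]

/-- Edge version. [cite: MochizukiSemiAnbd2006, Def 2.2(ii) p.24] -/
private theorem castGe_symm_castGe_hE {e e' : X.graph.Edge} (he' : e' = e)
    (h2 : F.base.edgeMap e = F.base.edgeMap e')
    (ε : X.Ge e' ≃ₜ* Y.Ge (F.base.edgeMap e')) (hε : ∀ x, ε x = F.hE e' x) (k : X.Ge e) :
    X.castGe he' (ε.symm (Y.castGe h2 (F.hE e k))) = k := by
  subst he'
  rw [castGe_rfl, castGe_rfl, ← hε, ContinuousMulEquiv.symm_apply_apply]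

variable [IsIso (C := SemiGraph.{u}) F.base]

/-- **Quasi-coherence descends along an isomorphism of presentations** (Def. 2.3 (iii)): push the
given coverings of the constituents of `X` forward to `Y` along the inverse isomorphisms
`Π_w ⥲ Π_{F⁻¹ w}` (restriction of scalars), split them by an approximator of `Y`, and pull the
approximator back. [cite: MochizukiSemiAnbd2006, Def 2.3(iii) p.25] -/
theorem isQuasiCoherent_of_iso (hlt : F.IsLocallyTrivial) (hY : Y.IsQuasiCoherent) :
    X.IsQuasiCoherent := by
  classical
  intro M HV HE hHV hHE
  -- the constituent isomorphisms and the inverse on the base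
  choose eV heV using fun v => exists_continuousMulEquiv_of_bijective (F.hV v) (hlt.1 v)
  choose eE heE using fun e => exists_continuousMulEquiv_of_bijective (F.hE e) (hlt.2 e)
  let iV : Y.graph.Vertex → X.graph.Vertex := (inv (show X.graph ⟶ Y.graph from F.base)).vertexMap
  let iE : Y.graph.Edge → X.graph.Edge := (inv (show X.graph ⟶ Y.graph from F.base)).edgeMap
  have hif : ∀ w, F.base.vertexMap (iV w) = w := SemiGraph.vertexMap_inv_vertexMap F.base
  have hife : ∀ e', F.base.edgeMap (iE e') = e' := SemiGraph.edgeMap_inv_edgeMap F.base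
  have hfi : ∀ v, iV (F.base.vertexMap v) = v := SemiGraph.inv_vertexMap_vertexMap F.base
  have hfie : ∀ e, iE (F.base.edgeMap e) = e := SemiGraph.inv_edgeMap_edgeMap F.base
  -- `Π_w → Π_{iV w}`
  let ψV : ∀ w : Y.graph.Vertex, Y.Gv w →ₜ* X.Gv (iV w) := fun w =>
    (ContinuousMonoidHom.toContinuousMonoidHom (eV (iV w)).symm).comp
      (ContinuousMonoidHom.toContinuousMonoidHom (Y.castGv (hif w).symm))
  let ψE : ∀ e' : Y.graph.Edge, Y.Ge e' →ₜ* X.Ge (iE e') := fun e' =>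
    (ContinuousMonoidHom.toContinuousMonoidHom (eE (iE e')).symm).comp
      (ContinuousMonoidHom.toContinuousMonoidHom (Y.castGe (hife e').symm))
  -- the pushed-forward families
  let HVY : ∀ w : Y.graph.Vertex, BTemp (Y.Gv w) := fun w => (BTemp.res (ψV w)).obj (HV (iV w))
  let HEY : ∀ e' : Y.graph.Edge, BTemp (Y.Ge e') := fun e' => (BTemp.res (ψE e')).obj (HE (iE e'))
  obtain ⟨A, hAV, hAE⟩ := hY M HVY HEY (fun w => hHV (iV w)) (fun e' => hHE (iE e'))
  obtain ⟨A', -, hkV, hkE, -⟩ := exists_approximator_of_iso F hlt A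
  refine ⟨A', fun v k hk => ?_, fun e k hk => ?_⟩
  · have h1 : A.πV (F.base.vertexMap v) (F.hV v k) = 1 := (hkV v k).mp hk
    have h2 := hAV (F.base.vertexMap v) (F.hV v k) h1
    -- `h2` : `ψV (F v) (hV k)` acts trivially on `HV (iV (F v))`
    refine forall_ρ_eq_of_castGv HV (hfi v) k (ψV _ (F.hV v k)) ?_ fun x => ?_
    · exact castGv_symm_castGv_hV F (hfi v) (hif (F.base.vertexMap v)).symm (eV _) (heV _) k
    · exact h2 x
  · have h1 : A.πE (F.base.edgeMap e) (F.hE e k) = 1 := (hkE e k).mp hk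
    have h2 := hAE (F.base.edgeMap e) (F.hE e k) h1
    refine forall_ρ_eq_of_castGe HE (hfie e) k (ψE _ (F.hE e k)) ?_ fun x => ?_
    · exact castGe_symm_castGe_hE F (hfie e) (hife (F.base.edgeMap e)).symm (eE _) (heE _) k
    · exact h2 x

end ProfiniteSemiGraph

end Literature.AnabelianGeometry.SemiGraphs
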